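import Mathlib
import Summits.PneNP.PneNP.Theorems.ConvexRankGatesConvexGateBlindRankPlusOne

/-!
# PneNP / ConvexRankGates — `ConvexGateBlind`: a valid inequality of the clique-free polytope catches ONE bare clique

Helpers (`--supports stmt-PneNP-10680`), COLUMN-SPACE line (prover seat 2, session 24): the combinatorial core of the
restricted class on the OTHER side of the LP slice of the crux (affine column objects; the factorisation consequences are in
`ConvexRankGatesConvexGateBlindAffineRank.lean`).

* `twoCliqueGraph_cliqueFree` — for `k`-sets `Q ≠ Q'` (`k ≥ 2`), `e ∈ E(Q) ∖ E(Q')`, `e' ∈ E(Q') ∖ E(Q)`, the graph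
  `(E(Q) − e) ∪ (E(Q') − e')` is `k`-clique-free (a `k`-clique lies inside `Q` or inside `Q'` — two of its vertices
  separated by the pair would not be adjacent — hence is `Q` or `Q'`, which miss `e`, `e'`).
* `caught_clique_unique` — **uniqueness of the caught clique.** For `3 ≤ k`, ANY real edge weighting `t` and any
  `a ≥ t(u)` for all `k`-clique-free `u` (a VALID INEQUALITY `t·x ≤ a` of the `k`-clique-free polytope): at most ONE `k`-set
  `Q` has `t(E(Q)) > a`. (WLOG `t ≥ 0`, clique-free graphs being closed under edge deletion; for `Q ≠ Q'` both caught, take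
  private edges `e`, `e'` of minimal weight — each at most half the private weight, `exists_small_private_edge`, since a
  vertex of `Q ∖ Q'` carries two private edges — and read the weight of the test graph from `Q` and from `Q'`:
  `t(A) + t(B) < 2(t_e + t_{e'}) ≤ t(A) + t(B)` for the private parts `A`, `B`.)
In words: the bare `k`-cliques are in "general position" with respect to the valid inequalities of the clique-free
polytope — no inequality is violated by two of them. [new]
-/

set_option linter.dupNamespace false

namespace Summit.PneNP.PneNP.Theorems

open Finset Real Filter Literature.Computability.Complexity
open Summit.PneNP.PneNP.Cruxes.ConvexGateBlind.StrictRankConicCover (Edge cdist)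

noncomputable section

variable {m : ℕ}

/-! ## Edge sets of cliques and the two-clique test graph -/

/-- The edge set `E(Q)` of the clique on `Q`, as a finset of edges of `K_m`. [folklore] -/
def cliqueEdges (Q : Finset (Fin m)) : Finset (Edge m) :=
  Finset.univ.filter fun e => cliqueVec Q e = true

/-- `e ∈ E(Q)` iff both endpoints of `e` lie in `Q`. [folklore] -/
theorem mem_cliqueEdges {Q : Finset (Fin m)} {e : Edge m} :
    e ∈ cliqueEdges Q ↔ ∀ v ∈ (e : Sym2 (Fin m)), v ∈ Q := by
  classical
  simp [cliqueEdges, cliqueVec]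

/-- The pair `{a, b}` (`a ≠ b`) is in `E(Q)` iff `a, b ∈ Q`. [folklore] -/
theorem mk_mem_cliqueEdges {Q : Finset (Fin m)} {a b : Fin m} (hab : a ≠ b) :
    (⟨s(a, b), by simpa using hab⟩ : Edge m) ∈ cliqueEdges Q ↔ a ∈ Q ∧ b ∈ Q := by
  rw [mem_cliqueEdges]
  simp

/-- The test graph `(E(Q) − e) ∪ (E(Q') − e')`. [new] -/
def twoCliqueGraph (Q Q' : Finset (Fin m)) (e e' : Edge m) : Edge m → Bool :=
  fun f => decide (f ∈ (cliqueEdges Q).erase e ∪ (cliqueEdges Q').erase e')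

/-- Swapping the two cliques gives the same test graph. [folklore] -/
theorem twoCliqueGraph_comm (Q Q' : Finset (Fin m)) (e e' : Edge m) :
    twoCliqueGraph Q' Q e' e = twoCliqueGraph Q Q' e e' := by
  funext f
  simp only [twoCliqueGraph, Finset.union_comm]

/-- Adjacent vertices of the test graph lie together in `Q` or together in `Q'`. [folklore] -/
theorem mem_or_mem_of_twoCliqueGraph_adj {Q Q' : Finset (Fin m)} {e e' : Edge m} {a b : Fin m}
    (h : (cliqueGraph (twoCliqueGraph Q Q' e e')).Adj a b) : (a ∈ Q ∧ b ∈ Q) ∨ (a ∈ Q' ∧ b ∈ Q') := by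
  classical
  rw [cliqueGraph_adj] at h
  obtain ⟨hab, hx⟩ := h
  simp only [twoCliqueGraph, decide_eq_true_eq, Finset.mem_union, Finset.mem_erase] at hx
  rcases hx with ⟨-, hQ⟩ | ⟨-, hQ'⟩
  · exact Or.inl ((mk_mem_cliqueEdges hab).1 hQ)
  · exact Or.inr ((mk_mem_cliqueEdges hab).1 hQ')

/-- A `k`-clique of a graph that sits inside a `k`-set `P` uses every edge of `P`. [folklore] -/
theorem apply_eq_true_of_isNClique {k : ℕ} {u : Edge m → Bool} {Z P : Finset (Fin m)}
    (hZ : (cliqueGraph u).IsNClique k Z) (hZP : Z ⊆ P) (hP : P.card = k) {f : Edge m}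
    (hf : f ∈ cliqueEdges P) : u f = true := by
  classical
  have hZeq : Z = P := Finset.eq_of_subset_of_card_le hZP (by rw [hP, hZ.card_eq])
  obtain ⟨z, hz⟩ := f
  induction z using Sym2.ind with
  | h a b =>
    have hab : a ≠ b := by simpa using hz
    have hmem := (mk_mem_cliqueEdges (Q := P) hab).1 hf
    have hadj : (cliqueGraph u).Adj a b :=
      hZ.isClique (by rw [Finset.mem_coe, hZeq]; exact hmem.1) (by rw [Finset.mem_coe, hZeq]; exact hmem.2) hab
    rw [cliqueGraph_adj] at hadj
    obtain ⟨hne, hx⟩ := hadj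
    exact hx

/-- **The two-clique test graph is `k`-clique-free.** If `#Q = #Q' = k ≥ 2`, `e ∈ E(Q) ∖ E(Q')` and `e' ∈ E(Q') ∖ E(Q)`,
then `(E(Q) − e) ∪ (E(Q') − e')` has no `k`-clique: a `k`-clique lies inside `Q` or inside `Q'` (two of its vertices
separated by the pair `(Q, Q')` would not be adjacent), hence equals `Q` or `Q'`, but `Q` misses `e` and `Q'` misses `e'`.
[new] -/
theorem twoCliqueGraph_cliqueFree {k : ℕ} (hk : 2 ≤ k) {Q Q' : Finset (Fin m)} (hQ : Q.card = k) (hQ' : Q'.card = k)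
    {e e' : Edge m} (he : e ∈ cliqueEdges Q) (heQ' : e ∉ cliqueEdges Q') (he' : e' ∈ cliqueEdges Q')
    (he'Q : e' ∉ cliqueEdges Q) : cliqueFn m k (twoCliqueGraph Q Q' e e') = false := by
  classical
  rw [cliqueFn_eq_false_iff]
  intro Z hZ
  set u := twoCliqueGraph Q Q' e e' with hu
  -- the missing edges
  have hue : u e = false := by
    rw [hu]
    simp only [twoCliqueGraph, decide_eq_false_iff_not, Finset.mem_union, Finset.mem_erase, not_or, not_and]
    exact ⟨fun h => absurd rfl h, fun _ => heQ'⟩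
  have hue' : u e' = false := by
    rw [hu]
    simp only [twoCliqueGraph, decide_eq_false_iff_not, Finset.mem_union, Finset.mem_erase, not_or, not_and]
    exact ⟨fun _ => he'Q, fun h => absurd rfl h⟩
  -- a `k`-clique lies inside `Q` or inside `Q'`
  have hsub : Z ⊆ Q ∨ Z ⊆ Q' := by
    by_contra hcon
    rw [not_or, Finset.not_subset, Finset.not_subset] at hcon
    obtain ⟨⟨z₁, hz₁Z, hz₁Q⟩, ⟨z₂, hz₂Z, hz₂Q'⟩⟩ := hcon
    by_cases h12 : z₁ = z₂
    · subst h12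
      -- `z₁` has a neighbour in `Z`
      have hcard : 1 < Z.card := by rw [hZ.card_eq]; omega
      obtain ⟨w, hwZ, hwz⟩ := Finset.exists_mem_ne hcard z₁
      rcases mem_or_mem_of_twoCliqueGraph_adj (hZ.isClique hz₁Z hwZ hwz.symm) with ⟨h1, -⟩ | ⟨h1, -⟩
      · exact hz₁Q h1
      · exact hz₂Q' h1
    · rcases mem_or_mem_of_twoCliqueGraph_adj (hZ.isClique hz₁Z hz₂Z h12) with ⟨h1, -⟩ | ⟨-, h2⟩
      · exact hz₁Q h1
      · exact hz₂Q' h2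
  rcases hsub with hZQ | hZQ'
  · have := apply_eq_true_of_isNClique hZ hZQ hQ he
    rw [hue] at this
    exact Bool.false_ne_true this
  · have := apply_eq_true_of_isNClique hZ hZQ' hQ' he'
    rw [hue'] at this
    exact Bool.false_ne_true this

/-! ## Sums over the test graph -/

/-- The weight of the test graph: at least `(t(E(Q)) − t_e) + (t(E(Q') ∖ E(Q)) − t_{e'})` for `t ≥ 0`. [folklore] -/
theorem sum_twoCliqueGraph_ge {Q Q' : Finset (Fin m)} {e e' : Edge m} (he : e ∈ cliqueEdges Q)
    (he' : e' ∈ cliqueEdges Q' \ cliqueEdges Q) (t : Edge m → ℝ) (ht : ∀ f, 0 ≤ t f) :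
    (∑ f ∈ cliqueEdges Q, t f) - t e + ((∑ f ∈ cliqueEdges Q' \ cliqueEdges Q, t f) - t e') ≤
      ∑ f, (if twoCliqueGraph Q Q' e e' f = true then t f else 0) := by
  classical
  have hsum : (∑ f, (if twoCliqueGraph Q Q' e e' f = true then t f else 0)) =
      ∑ f ∈ (cliqueEdges Q).erase e ∪ (cliqueEdges Q').erase e', t f := by
    simp only [twoCliqueGraph, decide_eq_true_eq]
    rw [Finset.sum_ite_mem, Finset.univ_inter]
  rw [hsum, ← Finset.sum_erase_eq_sub he, ← Finset.sum_erase_eq_sub he']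
  have hdisj : Disjoint ((cliqueEdges Q).erase e) ((cliqueEdges Q' \ cliqueEdges Q).erase e') :=
    Finset.disjoint_of_subset_left (Finset.erase_subset _ _)
      (Finset.disjoint_of_subset_right (Finset.erase_subset _ _) Finset.disjoint_sdiff)
  rw [← Finset.sum_union hdisj]
  refine Finset.sum_le_sum_of_subset_of_nonneg ?_ fun f _ _ => ht f
  exact Finset.union_subset_union le_rfl (Finset.erase_subset_erase _ Finset.sdiff_subset)

/-- Two `k`-sets of the same size that differ have, for `k ≥ 3`, a private edge of `Q` of weight at most half the private
weight (a minimal-weight edge among at least two private edges through a vertex of `Q ∖ Q'`). [folklore] -/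
theorem exists_small_private_edge {k : ℕ} (hk : 3 ≤ k) (t : Edge m → ℝ) (ht : ∀ f, 0 ≤ t f)
    {Q Q' : Finset (Fin m)} (hQ : Q.card = k) (hQ' : Q'.card = k) (hne : Q ≠ Q') :
    ∃ e ∈ cliqueEdges Q \ cliqueEdges Q', 2 * t e ≤ ∑ f ∈ cliqueEdges Q \ cliqueEdges Q', t f := by
  classical
  -- a vertex `x ∈ Q ∖ Q'` and two further vertices `y ≠ z` of `Q`
  have hnot : ¬ Q ⊆ Q' := fun h => hne (Finset.eq_of_subset_of_card_le h (by rw [hQ, hQ']))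
  obtain ⟨x, hxQ, hxQ'⟩ := Finset.not_subset.1 hnot
  have hcard : 1 < (Q.erase x).card := by rw [Finset.card_erase_of_mem hxQ, hQ]; omega
  obtain ⟨y, hy, z, hz, hyz⟩ := Finset.one_lt_card.1 hcard
  obtain ⟨hyx, hyQ⟩ := Finset.mem_erase.1 hy
  obtain ⟨hzx, hzQ⟩ := Finset.mem_erase.1 hz
  set e₁ : Edge m := ⟨s(x, y), by simpa using (Ne.symm hyx)⟩ with he₁
  set e₂ : Edge m := ⟨s(x, z), by simpa using (Ne.symm hzx)⟩ with he₂
  set A := cliqueEdges Q \ cliqueEdges Q' with hA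
  have he₁A : e₁ ∈ A := by
    rw [hA, Finset.mem_sdiff, mk_mem_cliqueEdges (Ne.symm hyx), mk_mem_cliqueEdges (Ne.symm hyx)]
    exact ⟨⟨hxQ, hyQ⟩, fun h => hxQ' h.1⟩
  have he₂A : e₂ ∈ A := by
    rw [hA, Finset.mem_sdiff, mk_mem_cliqueEdges (Ne.symm hzx), mk_mem_cliqueEdges (Ne.symm hzx)]
    exact ⟨⟨hxQ, hzQ⟩, fun h => hxQ' h.1⟩
  have h12 : e₁ ≠ e₂ := by
    intro h
    rw [he₁, he₂, Subtype.mk.injEq, Sym2.eq_iff] at h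
    rcases h with ⟨-, h⟩ | ⟨h, -⟩
    · exact hyz h
    · exact hzx h.symm
  -- a minimal-weight private edge
  obtain ⟨e, heA, hmin⟩ := Finset.exists_min_image A t ⟨e₁, he₁A⟩
  refine ⟨e, heA, ?_⟩
  have hpair : ∑ f ∈ ({e₁, e₂} : Finset (Edge m)), t f ≤ ∑ f ∈ A, t f :=
    Finset.sum_le_sum_of_subset_of_nonneg (Finset.insert_subset he₁A (Finset.singleton_subset_iff.2 he₂A))
      fun f _ _ => ht f
  rw [Finset.sum_pair h12] at hpair
  have h1 := hmin e₁ he₁A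
  have h2 := hmin e₂ he₂A
  linarith

/-! ## Uniqueness of the caught clique -/

/-- **Uniqueness, non-negative weightings.** For `3 ≤ k`, `t ≥ 0` and `a ≥ t(u)` for every `k`-clique-free `u`, at most
one `k`-set `Q` has `t(E(Q)) > a`. [new] -/
theorem caught_clique_unique_of_nonneg {k : ℕ} (hk : 3 ≤ k) (t : Edge m → ℝ) (ht : ∀ f, 0 ≤ t f) (a : ℝ)
    (hvalid : ∀ u : Edge m → Bool, cliqueFn m k u = false → (∑ f, if u f = true then t f else 0) ≤ a)
    {Q Q' : Finset (Fin m)} (hQ : Q.card = k) (hQ' : Q'.card = k)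
    (hcQ : a < ∑ f ∈ cliqueEdges Q, t f) (hcQ' : a < ∑ f ∈ cliqueEdges Q', t f) : Q = Q' := by
  classical
  by_contra hne
  obtain ⟨e, heA, heS⟩ := exists_small_private_edge hk t ht hQ hQ' hne
  obtain ⟨e', he'B, he'S⟩ := exists_small_private_edge hk t ht hQ' hQ (Ne.symm hne)
  obtain ⟨heQ, heQ'⟩ := Finset.mem_sdiff.1 heA
  obtain ⟨he'Q', he'Q⟩ := Finset.mem_sdiff.1 he'B
  -- the test graph is clique-free, so its weight is at most `a` …
  have hfree : cliqueFn m k (twoCliqueGraph Q Q' e e') = false :=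
    twoCliqueGraph_cliqueFree (by omega) hQ hQ' heQ heQ' he'Q' he'Q
  have hva := hvalid _ hfree
  -- … but it is large, seen from `Q` and seen from `Q'`
  have hge := sum_twoCliqueGraph_ge heQ he'B t ht
  have hge' := sum_twoCliqueGraph_ge he'Q' heA t ht
  rw [twoCliqueGraph_comm] at hge'
  have hA0 : 0 ≤ ∑ f ∈ cliqueEdges Q \ cliqueEdges Q', t f := Finset.sum_nonneg fun f _ => ht f
  have hB0 : 0 ≤ ∑ f ∈ cliqueEdges Q' \ cliqueEdges Q, t f := Finset.sum_nonneg fun f _ => ht f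
  linarith

/-- **Uniqueness of the caught clique.** For `3 ≤ k`, ANY real edge weighting `t` and `a ≥ t(u)` for every `k`-clique-free
graph `u` (i.e. `t·x ≤ a` is a valid inequality of the `k`-clique-free polytope), at most one `k`-set `Q` has `t(E(Q)) > a`:
no valid inequality is violated by two bare `k`-cliques. (Reduce to `t⁺`: clique-free graphs are closed under deleting
edges, so `t⁺(u) ≤ a` as well, and `t(E(Q)) ≤ t⁺(E(Q))`.) [new] -/
theorem caught_clique_unique {k : ℕ} (hk : 3 ≤ k) (t : Edge m → ℝ) (a : ℝ)
    (hvalid : ∀ u : Edge m → Bool, cliqueFn m k u = false → (∑ f, if u f = true then t f else 0) ≤ a)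
    {Q Q' : Finset (Fin m)} (hQ : Q.card = k) (hQ' : Q'.card = k)
    (hcQ : a < ∑ f ∈ cliqueEdges Q, t f) (hcQ' : a < ∑ f ∈ cliqueEdges Q', t f) : Q = Q' := by
  classical
  set s : Edge m → ℝ := fun f => max (t f) 0 with hs
  have hs0 : ∀ f, 0 ≤ s f := fun f => le_max_right _ _
  have hts : ∀ f, t f ≤ s f := fun f => le_max_left _ _
  refine caught_clique_unique_of_nonneg hk s hs0 a (fun u hu => ?_) hQ hQ'
    (hcQ.trans_le (Finset.sum_le_sum fun f _ => hts f)) (hcQ'.trans_le (Finset.sum_le_sum fun f _ => hts f))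
  -- delete the edges of negative weight: still clique-free, and its `t`-weight is the `t⁺`-weight of `u`
  set u' : Edge m → Bool := fun f => u f && decide (0 < t f) with hu'
  have hle : u' ≤ u := fun f => by
    rw [hu']
    dsimp only
    cases u f <;> simp
  have hu'free : cliqueFn m k u' = false := by
    have hmono := cliqueFn_monotone_holds m k hle
    rw [hu] at hmono
    exact le_bot_iff.1 hmono
  have hva := hvalid u' hu'free
  have heq : (∑ f, if u f = true then s f else 0) = ∑ f, if u' f = true then t f else 0 := by
    refine Finset.sum_congr rfl fun f _ => ?_
    rw [hu', hs]
    dsimp only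
    rcases Bool.eq_false_or_eq_true (u f) with h1 | h1
    · by_cases h : 0 < t f
      · simp [h1, h, max_eq_left h.le]
      · simp [h1, h, max_eq_right (not_lt.1 h)]
    · simp [h1]
  rw [heq]
  exact hva

/-- Clique sums over `cliqueEdges`. [folklore] -/
theorem sum_cliqueEdges (Q : Finset (Fin m)) (t : Edge m → ℝ) :
    ∑ f ∈ cliqueEdges Q, t f = ∑ f, (if cliqueVec Q f = true then t f else 0) := by
  classical
  rw [cliqueEdges, Finset.sum_filter]

/-- **Uniqueness of the caught clique** (registered form of `caught_clique_unique`, clique sums written out): for `3 ≤ k`,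
a valid inequality `t·x ≤ a` of the `k`-clique-free polytope is violated by at most one bare `k`-clique. [new] -/
theorem valid_inequality_catches_one : ∀ {m k : ℕ}, 3 ≤ k → ∀ (t : Edge m → ℝ) (a : ℝ), (∀ u : Edge m → Bool, cliqueFn m k u = false → (∑ f, if u f = true then t f else 0) ≤ a) → ∀ (Q Q' : Finset (Fin m)), Q.card = k → Q'.card = k → a < (∑ f, if cliqueVec Q f = true then t f else 0) → a < (∑ f, if cliqueVec Q' f = true then t f else 0) → Q = Q' :=
  fun hk t a hvalid Q Q' hQ hQ' hcQ hcQ' =>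
    caught_clique_unique hk t a hvalid hQ hQ' (by rwa [sum_cliqueEdges]) (by rwa [sum_cliqueEdges])

end

end Summit.PneNP.PneNP.Theorems
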